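import Mathlib
import Summits.ValiantsHypothesis.ValiantsHypothesis.Theses.ValuativeGCT
import Summits.ValiantsHypothesis.ValiantsHypothesis.Theorems.ValuativeGCTValuativeFlipSymBlowupMem
import Summits.ValiantsHypothesis.ValiantsHypothesis.Theorems.ValuativeGCTValuativeFlipExplicitLeStabInv
import Summits.ValiantsHypothesis.ValiantsHypothesis.Theorems.ValuativeGCTCutBites

/-!
# `ValuativeGCT.ValuativeFlip` (stmt-ValiantsHypothesis-12624), det census — THE CUT BITES AT THE FIRST RUNG
# (`δ = 2`) FOR EVERY CENTRE CONTAINING A `3 × 3` SKEW TRIANGLE AND AN INVERTIBLE COMPLEMENTARY BLOCK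

Wall-breaker axis "det-orbit-closure multiplicity bounds for the det census" (crux `ValuativeFlip`, route
`ValuativeGCT`).  The det side of the crux is the valuative truncation
`T_U(t, χ) = Hom_{mδ} ⊓ I(L_U)^t ⊓ (Stab_End(det_m)-invariants) ⊓ (B-semi-invariants of weight χ)` of the census
space `T_U(0, χ)` (the symmetric Kronecker space, `stabInv_eq_explicit`); the route's lever is that an Edmonds-gap
centre `U` makes `T_U(δ(m-r), λ*)` STRICTLY smaller than `T_U(0, λ*)` somewhere.  The tree had this only for ODD `m`,
for the skew centre `Λ_m`, at `δ = m - 1` (`CutBitesAdjugate.CutBites_proof`, crux stmt-12626), while the CutBites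
disprover showed that `δ = 2` is the FIRST possible rung and that there an order-`0` witness is necessary
(`CutBites.Negative.cutBites_firstRung_lt_iff_witness`); the `δ = 2` line `pfaffian-square-address` was never built,
and the route lists "the choice of `U` for even `m`" as not decomposed.

Main theorem `firstRung_bite_of_mem`: let `e : Fin 3 ⊕ κ ≃ Fin m` and let `U` be ANY space of row vectors containing
the three elementary skew matrices `E₀₁ - E₁₀, E₀₂ - E₂₀, E₁₂ - E₂₁` on the letters `e (inl ·)` and a block matrix
`0₃ ⊕ Y` with `det Y ≠ 0` (all placed by `Matrix.reindex e e ∘ Matrix.fromBlocks`).  Then for some `λ ⊢ 2m` with at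
most `m²` parts, `finrank T_U(t, λ*) < finrank T_U(0, λ*)` for EVERY `t ≥ 1` — in degree `m · 2`, the first rung.
Since the census `T_U(0, ·)` does not depend on `U` and `T_U(t, ·)` is antitone in `U`
(`ValuativeGCTNoValuativeFlipMonotone`), every larger centre bites as well; the corollaries for the route's centres
(`Λ_m`, `m` odd; `Λ_{m-1} ⊕ E_{mm}` and `Λ_3 ⊕ D_{m-3}`, every `m ≥ 3`, even `m` included) are in the companion file
`ValuativeGCTValuativeFlipFirstRungBiteCentres`.

Mechanism (line `pfaffian-square-address` of crux CutBites, for all centres at once).  Witness: the τ-symmetrised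
level-2 blow-up `G_T = det(∑_j T_j ⊗ X_j) + det(∑_j T_jᵀ ⊗ X_j)` (Domokos–Zubkov / Schofield–van den Bergh /
Derksen–Weyman semi-invariants) with the SYMMETRIC data `T = (1, σ_x, σ_z, 1)` on the row slots
`(0,1), (0,2), (1,2), (0,0)` and `T = 0` elsewhere; it is a form of degree `m · 2`, sandwich- and transpose-invariant
(`stub_symBlowup_mem`), hence invariant under the abstract `End`-stabiliser of `det_m` (Frobenius,
`explicit_le_stabInv`).  At the point of `L_U` whose four non-zero rows are the four matrices above, the numerical
blow-up matrix is `1 ⊗ M_P + σ_x ⊗ M_Q + σ_z ⊗ M_R + 1 ⊗ M_Y`, block diagonal `K₃ ⊕ (1 ⊗ Y)` along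
`Fin 2 × (Fin 3 ⊕ κ) ≃ (Fin 2 × Fin 3) ⊕ (Fin 2 × κ)` (`frg_submatrix_kronecker_fromBlocks`, `frg_det_blocks`,
`frg_det_level`), with the `6 × 6` core `K₃ = 1 ⊗ s_P + σ_x ⊗ s_Q + σ_z ⊗ s_R` invertible (explicit inverse,
`frg_core_mul_inv`; `det K₃ = 4`), so `G_T = 2 det K₃ (det Y)² ≠ 0` there.  Highest-weight extraction
(`CutBitesAdjugate.stub_hwExtraction`: complete reducibility + Lie–Kolchin, `L_U` is left-stable) produces a
`B`-semi-invariant `G' ∈ T_U(0, λ*)` non-zero on `L_U`, and the cut criterion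
(`CutBitesAdjugate.finrank_lt_of_eval_ne_zero`) gives the strict inequality at every `t ≥ 1`.

Det-census reading: in the lowest degree where the census is not just `Φ(Sym²(Sym^m))` (BLMW: `sk > K_m` first at
`δ = 2`, types with three or four even rows), every Edmonds-gap centre built on a `Λ_3`-triangle already cuts the
symmetric Kronecker space strictly: `K_m(λ*) ≤ K̃_m(λ*) ≤ dim T_U(2(m-r), λ*) < sk(λ; 2^m)` for some `λ ⊢ 2m`.

References: M. Domokos, A. N. Zubkov, Transform. Groups 6 (2001) 9–24, Thm. 1.1 (doi:10.1007/bf01236060);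
H. Derksen, V. Makam, Adv. Math. 310 (2017) 44–63 (arXiv:1512.03531); BLMW, SIAM J. Comput. 40 (2011) §5.2
(arXiv:0907.2850); G. Frobenius 1897 / M. Marcus, B. Moyls, Canad. J. Math. 11 (1959) Thm. 2.
-/

namespace Summit.ValiantsHypothesis.ValiantsHypothesis.Theorems.ValuativeFlip

open scoped BigOperators Matrix Kronecker

-- `Summit.ValiantsHypothesis.ValiantsHypothesis.…` is the tree's mandated single-conjunct layout (Sub = Summit).
set_option linter.dupNamespace false

noncomputable section

/-! ### §1 The `6 × 6` core `K₃ = 1 ⊗ s_P + σ_x ⊗ s_Q + σ_z ⊗ s_R` is invertible -/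

/-- The core matrix `K₃ = 1 ⊗ (E₀₁-E₁₀) + σ_x ⊗ (E₀₂-E₂₀) + σ_z ⊗ (E₁₂-E₂₁)` (the symmetric `2 × 2` blow-up of the
three elementary `3 × 3` skew matrices) has an explicit right inverse (`det K₃ = 4`, `K₃⁻¹ = V` below). [folklore] -/
theorem frg_core_mul_inv :
    ((1 : Matrix (Fin 2) (Fin 2) ℂ) ⊗ₖ (!![0, 1, 0; -1, 0, 0; 0, 0, 0] : Matrix (Fin 3) (Fin 3) ℂ) +
        (!![0, 1; 1, 0] : Matrix (Fin 2) (Fin 2) ℂ) ⊗ₖ (!![0, 0, 1; 0, 0, 0; -1, 0, 0] : Matrix (Fin 3) (Fin 3) ℂ) +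
        (!![1, 0; 0, -1] : Matrix (Fin 2) (Fin 2) ℂ) ⊗ₖ (!![0, 0, 0; 0, 0, 1; 0, -1, 0] : Matrix (Fin 3) (Fin 3) ℂ)) *
      (Matrix.of fun a b : Fin 2 × Fin 3 =>
        (![![![![0, -1/2, 0], ![1/2, 0, -1/2]],
             ![![1/2, 0, -1/2], ![0, 1/2, 0]],
             ![![0, 1/2, 0], ![1/2, 0, -1/2]]],
           ![![![-1/2, 0, -1/2], ![0, -1/2, 0]],
             ![![0, -1/2, 0], ![1/2, 0, 1/2]],
             ![![1/2, 0, 1/2], ![0, -1/2, 0]]]] : Fin 2 → Fin 3 → Fin 2 → Fin 3 → ℂ) a.1 a.2 b.1 b.2) = 1 := by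
  ext ⟨a1, a2⟩ ⟨b1, b2⟩
  fin_cases a1 <;> fin_cases a2 <;> fin_cases b1 <;> fin_cases b2 <;>
    simp [Matrix.mul_apply, Fintype.sum_prod_type, Fin.sum_univ_two, Fin.sum_univ_three,
      Matrix.kroneckerMap_apply, Matrix.one_apply] <;> norm_num

/-- Hence `det K₃ ≠ 0`. [folklore] -/
theorem frg_core_det_ne_zero :
    ((1 : Matrix (Fin 2) (Fin 2) ℂ) ⊗ₖ (!![0, 1, 0; -1, 0, 0; 0, 0, 0] : Matrix (Fin 3) (Fin 3) ℂ) +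
        (!![0, 1; 1, 0] : Matrix (Fin 2) (Fin 2) ℂ) ⊗ₖ (!![0, 0, 1; 0, 0, 0; -1, 0, 0] : Matrix (Fin 3) (Fin 3) ℂ) +
        (!![1, 0; 0, -1] : Matrix (Fin 2) (Fin 2) ℂ) ⊗ₖ (!![0, 0, 0; 0, 0, 1; 0, -1, 0] : Matrix (Fin 3) (Fin 3) ℂ)).det
      ≠ 0 :=
  (Matrix.isUnit_det_of_right_inverse frg_core_mul_inv).ne_zero

/-! ### §2 Block-diagonal structure of the certificate matrix -/

/-- Distributing a Kronecker factor over `fromBlocks`: along `Fin 2 × (α ⊕ κ) ≃ (Fin 2 × α) ⊕ (Fin 2 × κ)`,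
`T ⊗ fromBlocks A B C D` is `fromBlocks (T ⊗ A) (T ⊗ B) (T ⊗ C) (T ⊗ D)`. [folklore] -/
theorem frg_submatrix_kronecker_fromBlocks {l α κ : Type*} (T : Matrix l l ℂ) (A : Matrix α α ℂ)
    (B : Matrix α κ ℂ) (C : Matrix κ α ℂ) (D : Matrix κ κ ℂ) :
    (T ⊗ₖ Matrix.fromBlocks A B C D).submatrix (Equiv.prodSumDistrib l α κ).symm (Equiv.prodSumDistrib l α κ).symm =
      Matrix.fromBlocks (T ⊗ₖ A) (T ⊗ₖ B) (T ⊗ₖ C) (T ⊗ₖ D) := by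
  ext (⟨i, a⟩ | ⟨i, a⟩) (⟨j, b⟩ | ⟨j, b⟩) <;>
    simp [Matrix.submatrix_apply, Matrix.kroneckerMap_apply, Matrix.fromBlocks]

/-- The certificate matrix at level `Fin 3 ⊕ κ` is block diagonal `K₃ ⊕ (1 ⊗ Y)`, so its determinant is
`det K₃ · (det Y)²`. [folklore] -/
theorem frg_det_blocks {κ : Type*} [Fintype κ] [DecidableEq κ] (Y : Matrix κ κ ℂ) :
    ((1 : Matrix (Fin 2) (Fin 2) ℂ) ⊗ₖ Matrix.fromBlocks (!![0, 1, 0; -1, 0, 0; 0, 0, 0] : Matrix (Fin 3) (Fin 3) ℂ) 0 0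
          (0 : Matrix κ κ ℂ) +
        (!![0, 1; 1, 0] : Matrix (Fin 2) (Fin 2) ℂ) ⊗ₖ
          Matrix.fromBlocks (!![0, 0, 1; 0, 0, 0; -1, 0, 0] : Matrix (Fin 3) (Fin 3) ℂ) 0 0 (0 : Matrix κ κ ℂ) +
        (!![1, 0; 0, -1] : Matrix (Fin 2) (Fin 2) ℂ) ⊗ₖ
          Matrix.fromBlocks (!![0, 0, 0; 0, 0, 1; 0, -1, 0] : Matrix (Fin 3) (Fin 3) ℂ) 0 0 (0 : Matrix κ κ ℂ) +
        (1 : Matrix (Fin 2) (Fin 2) ℂ) ⊗ₖ Matrix.fromBlocks (0 : Matrix (Fin 3) (Fin 3) ℂ) 0 0 Y).det =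
      ((1 : Matrix (Fin 2) (Fin 2) ℂ) ⊗ₖ (!![0, 1, 0; -1, 0, 0; 0, 0, 0] : Matrix (Fin 3) (Fin 3) ℂ) +
        (!![0, 1; 1, 0] : Matrix (Fin 2) (Fin 2) ℂ) ⊗ₖ (!![0, 0, 1; 0, 0, 0; -1, 0, 0] : Matrix (Fin 3) (Fin 3) ℂ) +
        (!![1, 0; 0, -1] : Matrix (Fin 2) (Fin 2) ℂ) ⊗ₖ (!![0, 0, 0; 0, 0, 1; 0, -1, 0] : Matrix (Fin 3) (Fin 3) ℂ)).det *
        Y.det ^ 2 := by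
  rw [← Matrix.det_reindex_self (Equiv.prodSumDistrib (Fin 2) (Fin 3) κ)]
  simp only [Matrix.reindex_apply, Matrix.submatrix_add, Pi.add_apply, frg_submatrix_kronecker_fromBlocks,
    Matrix.fromBlocks_add, Matrix.kronecker_zero, add_zero, zero_add]
  rw [Matrix.det_fromBlocks_zero₂₁, Matrix.det_kronecker, Matrix.det_one, one_pow, one_mul,
    Fintype.card_fin]

/-- The same after transport to `Fin m` along any `e : Fin 3 ⊕ κ ≃ Fin m` (the blocks placed by `reindex e e`).
[folklore] -/
theorem frg_det_level {m : ℕ} {κ : Type*} [Fintype κ] [DecidableEq κ] (e : Fin 3 ⊕ κ ≃ Fin m) (Y : Matrix κ κ ℂ) :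
    ((1 : Matrix (Fin 2) (Fin 2) ℂ) ⊗ₖ Matrix.reindex e e
          (Matrix.fromBlocks (!![0, 1, 0; -1, 0, 0; 0, 0, 0] : Matrix (Fin 3) (Fin 3) ℂ) 0 0 (0 : Matrix κ κ ℂ)) +
        (!![0, 1; 1, 0] : Matrix (Fin 2) (Fin 2) ℂ) ⊗ₖ Matrix.reindex e e
          (Matrix.fromBlocks (!![0, 0, 1; 0, 0, 0; -1, 0, 0] : Matrix (Fin 3) (Fin 3) ℂ) 0 0 (0 : Matrix κ κ ℂ)) +
        (!![1, 0; 0, -1] : Matrix (Fin 2) (Fin 2) ℂ) ⊗ₖ Matrix.reindex e e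
          (Matrix.fromBlocks (!![0, 0, 0; 0, 0, 1; 0, -1, 0] : Matrix (Fin 3) (Fin 3) ℂ) 0 0 (0 : Matrix κ κ ℂ)) +
        (1 : Matrix (Fin 2) (Fin 2) ℂ) ⊗ₖ Matrix.reindex e e (Matrix.fromBlocks (0 : Matrix (Fin 3) (Fin 3) ℂ) 0 0 Y)).det =
      ((1 : Matrix (Fin 2) (Fin 2) ℂ) ⊗ₖ (!![0, 1, 0; -1, 0, 0; 0, 0, 0] : Matrix (Fin 3) (Fin 3) ℂ) +
        (!![0, 1; 1, 0] : Matrix (Fin 2) (Fin 2) ℂ) ⊗ₖ (!![0, 0, 1; 0, 0, 0; -1, 0, 0] : Matrix (Fin 3) (Fin 3) ℂ) +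
        (!![1, 0; 0, -1] : Matrix (Fin 2) (Fin 2) ℂ) ⊗ₖ (!![0, 0, 0; 0, 0, 1; 0, -1, 0] : Matrix (Fin 3) (Fin 3) ℂ)).det *
        Y.det ^ 2 := by
  simp only [Matrix.kroneckerMap_reindex_right]
  rw [← frg_det_blocks Y, ← Matrix.det_reindex_self ((Equiv.refl (Fin 2)).prodCongr e).symm]
  simp only [Matrix.reindex_apply, Matrix.submatrix_add, Pi.add_apply, Matrix.submatrix_submatrix,
    Equiv.symm_symm, Equiv.symm_comp_self, Matrix.submatrix_id_id]


/-! ### §3 The certificate: evaluation of the symmetric `2 × 2` blow-up at the sparse point -/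

open Literature.NumberTheory.DiophantineGeometry Literature.Computability.AlgebraicComplexity
open MvPolynomial

/-- Evaluating the blow-up determinant `det B_T` at a point `p` of `End(ℂ^{m×m})` gives the determinant of the
numerical blow-up matrix `((a₁,a₂),(b₁,b₂)) ↦ ∑_j T_j a₁ b₁ · p (j, toLex (a₂, b₂))`. [folklore] -/
theorem frg_eval_det_blowup {m δ : ℕ} (T : MatIdx m → Matrix (Fin δ) (Fin δ) ℂ) (p : MatIdx m × MatIdx m → ℂ) :
    MvPolynomial.eval p
        (Matrix.of fun a b : Fin δ × Fin m =>
          ∑ j : MatIdx m, T j a.1 b.1 • MvPolynomial.X (R := ℂ) (j, toLex (a.2, b.2))).det =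
      (Matrix.of fun a b : Fin δ × Fin m => ∑ j : MatIdx m, T j a.1 b.1 * p (j, toLex (a.2, b.2))).det := by
  rw [RingHom.map_det]
  congr 1
  ext a b
  simp only [RingHom.mapMatrix_apply, Matrix.map_apply, Matrix.of_apply, map_sum, smul_eval, eval_X]

/-- If the rows of `p` are the matrices `S j`, the numerical blow-up matrix is `∑_j T_j ⊗ S_j`. [folklore] -/
theorem frg_blowup_point_eq_sum_kronecker {m δ : ℕ} (T : MatIdx m → Matrix (Fin δ) (Fin δ) ℂ)
    (S : MatIdx m → Matrix (Fin m) (Fin m) ℂ) :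
    (Matrix.of fun a b : Fin δ × Fin m =>
        ∑ j : MatIdx m, T j a.1 b.1 * (fun q : MatIdx m × MatIdx m => S q.1 (ofLex q.2).1 (ofLex q.2).2)
          (j, toLex (a.2, b.2))) =
      ∑ j : MatIdx m, T j ⊗ₖ S j := by
  ext a b
  simp only [Matrix.of_apply, ofLex_toLex, Matrix.sum_apply, Matrix.kroneckerMap_apply]

/-- Summing a four-slot assignment over all slots (distinct slots). [folklore] -/
theorem frg_sum_ite_four {ι M : Type*} [Fintype ι] [DecidableEq ι] [AddCommMonoid M] {j₁ j₂ j₃ j₄ : ι}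
    (h₁₂ : j₁ ≠ j₂) (h₁₃ : j₁ ≠ j₃) (h₁₄ : j₁ ≠ j₄) (h₂₃ : j₂ ≠ j₃) (h₂₄ : j₂ ≠ j₄) (h₃₄ : j₃ ≠ j₄)
    (v₁ v₂ v₃ v₄ : M) :
    ∑ j : ι, (if j = j₁ then v₁ else if j = j₂ then v₂ else if j = j₃ then v₃ else if j = j₄ then v₄ else 0) =
      v₁ + v₂ + v₃ + v₄ := by
  have h : (fun j : ι => if j = j₁ then v₁ else if j = j₂ then v₂ else if j = j₃ then v₃ else if j = j₄ then v₄ else 0) =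
      fun j => (if j = j₁ then v₁ else 0) + (if j = j₂ then v₂ else 0) + (if j = j₃ then v₃ else 0) +
        (if j = j₄ then v₄ else 0) := by
    funext j
    by_cases e₁ : j = j₁
    · subst e₁; simp [h₁₂, h₁₃, h₁₄]
    by_cases e₂ : j = j₂
    · subst e₂; simp [e₁, h₂₃, h₂₄]
    by_cases e₃ : j = j₃
    · subst e₃; simp [e₁, e₂, h₃₄]
    by_cases e₄ : j = j₄
    · subst e₄; simp [e₁, e₂, e₃]
    · simp [e₁, e₂, e₃, e₄]
  rw [h]
  simp only [Finset.sum_add_distrib, Finset.sum_ite_eq', Finset.mem_univ, if_true]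

/-! ### §4 The general first-rung bite -/

/-- **The cut bites at the first rung `δ = 2` as soon as the centre contains a `3 × 3` skew triangle and an
invertible complementary block.**  Let `e : Fin 3 ⊕ κ ≃ Fin m` place three letters `e(inl 0), e(inl 1), e(inl 2)`
and a complementary block `κ`, and let `U` be ANY linear space of `m × m` matrices (rows `u : MatIdx m → ℂ`)
containing the three elementary skew matrices `E₀₁ - E₁₀`, `E₀₂ - E₂₀`, `E₁₂ - E₂₁` on the letters and the block
matrix `0₃ ⊕ Y` with `det Y ≠ 0`.  Then some weight `λ* = (dualOfPartition (m·m) λ).toMatIdx`, `λ ⊢ 2m`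
(`≤ m²` parts), has `finrank T_U(t, λ*) < finrank T_U(0, λ*)` for EVERY threshold `t ≥ 1`, where
`T_U(t, χ) = Hom_{2m} ⊓ I(L_U)^t ⊓ (Stab_End(det_m)-invariants) ⊓ (B-semi-invariants of weight χ)` is the crux's
valuative truncation in degree `m · 2` (written verbatim).  Witness: the τ-symmetrised level-2 blow-up
`G_T = det(∑_j T_j ⊗ X_j) + det(∑_j T_jᵀ ⊗ X_j)` with `T = (1, σ_x, σ_z, 1)` on the row slots `(0,1), (0,2), (1,2), (0,0)`
(explicit invariant by `stub_symBlowup_mem`, abstract invariant by Frobenius `explicit_le_stabInv`); at the point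
of `L_U` whose rows are the four matrices above its value is `2 · det K₃ · (det Y)² ≠ 0` (`frg_det_level`,
`frg_core_det_ne_zero`); highest-weight extraction (`stub_hwExtraction`) and the cut criterion
(`finrank_lt_of_eval_ne_zero`) finish.  This is the line `pfaffian-square-address` of crux CutBites made a
theorem for every centre at once. [folklore; Domokos–Zubkov doi:10.1007/bf01236060 (level-2 semi-invariants)] -/
theorem firstRung_bite_of_mem {m : ℕ} {κ : Type*} [Fintype κ] [DecidableEq κ] (e : Fin 3 ⊕ κ ≃ Fin m)
    (Y : Matrix κ κ ℂ) (hY : Y.det ≠ 0) (U : Submodule ℂ (MatIdx m → ℂ))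
    (hP : (fun i : MatIdx m => Matrix.reindex e e
        (Matrix.fromBlocks (!![0, 1, 0; -1, 0, 0; 0, 0, 0] : Matrix (Fin 3) (Fin 3) ℂ) 0 0 (0 : Matrix κ κ ℂ))
        (ofLex i).1 (ofLex i).2) ∈ U)
    (hQ : (fun i : MatIdx m => Matrix.reindex e e
        (Matrix.fromBlocks (!![0, 0, 1; 0, 0, 0; -1, 0, 0] : Matrix (Fin 3) (Fin 3) ℂ) 0 0 (0 : Matrix κ κ ℂ))
        (ofLex i).1 (ofLex i).2) ∈ U)
    (hR : (fun i : MatIdx m => Matrix.reindex e e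
        (Matrix.fromBlocks (!![0, 0, 0; 0, 0, 1; 0, -1, 0] : Matrix (Fin 3) (Fin 3) ℂ) 0 0 (0 : Matrix κ κ ℂ))
        (ofLex i).1 (ofLex i).2) ∈ U)
    (hYU : (fun i : MatIdx m => Matrix.reindex e e
        (Matrix.fromBlocks (0 : Matrix (Fin 3) (Fin 3) ℂ) 0 0 Y) (ofLex i).1 (ofLex i).2) ∈ U) :
    ∃ lam : Nat.Partition (m * 2), lam.parts.card ≤ m * m ∧ ∀ t : ℕ, 0 < t →
      Module.finrank ℂ ↥(MvPolynomial.homogeneousSubmodule (MatIdx m × MatIdx m) ℂ (m * 2)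
        ⊓ ((MvPolynomial.vanishingIdeal ℂ {p : MatIdx m × MatIdx m → ℂ |
              ∀ j : MatIdx m, (fun i => p (j, i)) ∈ U}) ^ t).restrictScalars ℂ
        ⊓ (⨅ (M : Matrix (MatIdx m) (MatIdx m) ℂ)
            (_ : linSubst (MatIdx m) ℂ M (detFormLex ℂ m) = detFormLex ℂ m),
            LinearMap.ker ((MvPolynomial.aeval (R := ℂ) fun p : MatIdx m × MatIdx m =>
              ∑ l : MatIdx m, M l p.2 • MvPolynomial.X (p.1, l)).toLinearMap
              - LinearMap.id (R := ℂ) (M := MvPolynomial (MatIdx m × MatIdx m) ℂ)))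
        ⊓ (⨅ (g : Matrix.GeneralLinearGroup (MatIdx m) ℂ) (_ : IsUpperTriangular g),
            LinearMap.ker ((MvPolynomial.aeval (R := ℂ) fun p : MatIdx m × MatIdx m =>
              ∑ l : MatIdx m, ((g⁻¹ : Matrix.GeneralLinearGroup (MatIdx m) ℂ) :
                Matrix (MatIdx m) (MatIdx m) ℂ) p.1 l • MvPolynomial.X (l, p.2)).toLinearMap
              - weightChar ((Weight.dualOfPartition (m * m) lam).toMatIdx) g •
                LinearMap.id (R := ℂ) (M := MvPolynomial (MatIdx m × MatIdx m) ℂ))))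
      < Module.finrank ℂ ↥(MvPolynomial.homogeneousSubmodule (MatIdx m × MatIdx m) ℂ (m * 2)
        ⊓ ((MvPolynomial.vanishingIdeal ℂ {p : MatIdx m × MatIdx m → ℂ |
              ∀ j : MatIdx m, (fun i => p (j, i)) ∈ U}) ^ 0).restrictScalars ℂ
        ⊓ (⨅ (M : Matrix (MatIdx m) (MatIdx m) ℂ)
            (_ : linSubst (MatIdx m) ℂ M (detFormLex ℂ m) = detFormLex ℂ m),
            LinearMap.ker ((MvPolynomial.aeval (R := ℂ) fun p : MatIdx m × MatIdx m =>
              ∑ l : MatIdx m, M l p.2 • MvPolynomial.X (p.1, l)).toLinearMap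
              - LinearMap.id (R := ℂ) (M := MvPolynomial (MatIdx m × MatIdx m) ℂ)))
        ⊓ (⨅ (g : Matrix.GeneralLinearGroup (MatIdx m) ℂ) (_ : IsUpperTriangular g),
            LinearMap.ker ((MvPolynomial.aeval (R := ℂ) fun p : MatIdx m × MatIdx m =>
              ∑ l : MatIdx m, ((g⁻¹ : Matrix.GeneralLinearGroup (MatIdx m) ℂ) :
                Matrix (MatIdx m) (MatIdx m) ℂ) p.1 l • MvPolynomial.X (l, p.2)).toLinearMap
              - weightChar ((Weight.dualOfPartition (m * m) lam).toMatIdx) g •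
                LinearMap.id (R := ℂ) (M := MvPolynomial (MatIdx m × MatIdx m) ℂ)))) := by
  classical
  -- the three letters and the four row slots
  set c : Fin 3 → Fin m := fun i => e (Sum.inl i) with hc
  have hcinj : Function.Injective c := fun i j h => Sum.inl_injective (e.injective h)
  set jP : MatIdx m := toLex (c 0, c 1) with hjP
  set jQ : MatIdx m := toLex (c 0, c 2) with hjQ
  set jR : MatIdx m := toLex (c 1, c 2) with hjR
  set jY : MatIdx m := toLex (c 0, c 0) with hjY
  have hne : ∀ {a b a' b' : Fin 3}, (a, b) ≠ (a', b') → (toLex (c a, c b) : MatIdx m) ≠ toLex (c a', c b') := by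
    intro a b a' b' h h'
    apply h
    have h'' := toLex.injective h'
    simp only [Prod.mk.injEq] at h'' ⊢
    exact ⟨hcinj h''.1, hcinj h''.2⟩
  have hPQ : jP ≠ jQ := hne (by decide)
  have hPR : jP ≠ jR := hne (by decide)
  have hPY : jP ≠ jY := hne (by decide)
  have hQR : jQ ≠ jR := hne (by decide)
  have hQY : jQ ≠ jY := hne (by decide)
  have hRY : jR ≠ jY := hne (by decide)
  -- the four row matrices
  set MP : Matrix (Fin m) (Fin m) ℂ := Matrix.reindex e e
    (Matrix.fromBlocks (!![0, 1, 0; -1, 0, 0; 0, 0, 0] : Matrix (Fin 3) (Fin 3) ℂ) 0 0 (0 : Matrix κ κ ℂ)) with hMP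
  set MQ : Matrix (Fin m) (Fin m) ℂ := Matrix.reindex e e
    (Matrix.fromBlocks (!![0, 0, 1; 0, 0, 0; -1, 0, 0] : Matrix (Fin 3) (Fin 3) ℂ) 0 0 (0 : Matrix κ κ ℂ)) with hMQ
  set MR : Matrix (Fin m) (Fin m) ℂ := Matrix.reindex e e
    (Matrix.fromBlocks (!![0, 0, 0; 0, 0, 1; 0, -1, 0] : Matrix (Fin 3) (Fin 3) ℂ) 0 0 (0 : Matrix κ κ ℂ)) with hMR
  set MY : Matrix (Fin m) (Fin m) ℂ := Matrix.reindex e e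
    (Matrix.fromBlocks (0 : Matrix (Fin 3) (Fin 3) ℂ) 0 0 Y) with hMY
  -- blow-up data and the point
  set σx : Matrix (Fin 2) (Fin 2) ℂ := !![0, 1; 1, 0] with hσx
  set σz : Matrix (Fin 2) (Fin 2) ℂ := !![1, 0; 0, -1] with hσz
  set T : MatIdx m → Matrix (Fin 2) (Fin 2) ℂ := fun j =>
    if j = jP then 1 else if j = jQ then σx else if j = jR then σz else if j = jY then 1 else 0 with hT
  set S : MatIdx m → Matrix (Fin m) (Fin m) ℂ := fun j =>
    if j = jP then MP else if j = jQ then MQ else if j = jR then MR else if j = jY then MY else 0 with hS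
  set p : MatIdx m × MatIdx m → ℂ := fun q => S q.1 (ofLex q.2).1 (ofLex q.2).2 with hp
  -- all rows of `p` lie in `U`
  have hpU : ∀ j : MatIdx m, (fun i => p (j, i)) ∈ U := by
    intro j
    simp only [hp, hS]
    split_ifs
    · exact hP
    · exact hQ
    · exact hR
    · exact hYU
    · simp only [Matrix.zero_apply]
      exact U.zero_mem
  -- `T` is symmetric
  have hTt : (fun j => (T j)ᵀ) = T := by
    funext j
    simp only [hT]
    split_ifs
    · exact Matrix.transpose_one
    · ext i j; fin_cases i <;> fin_cases j <;> rfl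
    · ext i j; fin_cases i <;> fin_cases j <;> rfl
    · exact Matrix.transpose_one
    · exact Matrix.transpose_zero
  -- the numerical blow-up matrix at `p`
  have hTS : ∀ j, T j ⊗ₖ S j =
      if j = jP then (1 : Matrix (Fin 2) (Fin 2) ℂ) ⊗ₖ MP else if j = jQ then σx ⊗ₖ MQ else
        if j = jR then σz ⊗ₖ MR else if j = jY then (1 : Matrix (Fin 2) (Fin 2) ℂ) ⊗ₖ MY else 0 := by
    intro j
    simp only [hT, hS]
    split_ifs <;> simp
  have hsum : ∑ j : MatIdx m, T j ⊗ₖ S j =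
      (1 : Matrix (Fin 2) (Fin 2) ℂ) ⊗ₖ MP + σx ⊗ₖ MQ + σz ⊗ₖ MR + (1 : Matrix (Fin 2) (Fin 2) ℂ) ⊗ₖ MY := by
    simp only [hTS]
    exact frg_sum_ite_four hPQ hPR hPY hQR hQY hRY _ _ _ _
  have hmat : (Matrix.of fun a b : Fin 2 × Fin m => ∑ j : MatIdx m, T j a.1 b.1 * p (j, toLex (a.2, b.2))) =
      ∑ j : MatIdx m, T j ⊗ₖ S j := by
    simp only [hp]
    exact frg_blowup_point_eq_sum_kronecker T S
  have hdet : MvPolynomial.eval p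
      (Matrix.of fun a b : Fin 2 × Fin m =>
        ∑ j : MatIdx m, T j a.1 b.1 • MvPolynomial.X (R := ℂ) (j, toLex (a.2, b.2))).det ≠ 0 := by
    rw [frg_eval_det_blowup, hmat, hsum, hMP, hMQ, hMR, hMY, hσx, hσz, frg_det_level e Y]
    exact mul_ne_zero frg_core_det_ne_zero (pow_ne_zero _ hY)
  -- the witness and its properties
  set G : MvPolynomial (MatIdx m × MatIdx m) ℂ :=
    (Matrix.of fun a b : Fin 2 × Fin m =>
        ∑ j : MatIdx m, T j a.1 b.1 • MvPolynomial.X (R := ℂ) (j, toLex (a.2, b.2))).det +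
      (Matrix.of fun a b : Fin 2 × Fin m =>
        ∑ j : MatIdx m, (T j)ᵀ a.1 b.1 • MvPolynomial.X (R := ℂ) (j, toLex (a.2, b.2))).det with hG
  obtain ⟨hGh, hGsand, hGtr⟩ := stub_symBlowup_mem m 2 T
  have hGp : MvPolynomial.eval p G ≠ 0 := by
    have hTt' : ∀ j, (T j)ᵀ = T j := fun j => congr_fun hTt j
    simp only [hG, hTt', map_add]
    intro h
    exact hdet (add_self_eq_zero.mp h)
  have hGs : ∀ M : Matrix (MatIdx m) (MatIdx m) ℂ, linSubst (MatIdx m) ℂ M (detFormLex ℂ m) = detFormLex ℂ m →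
      MvPolynomial.aeval (R := ℂ) (fun q : MatIdx m × MatIdx m =>
        ∑ l : MatIdx m, M l q.2 • (X (q.1, l) : MvPolynomial (MatIdx m × MatIdx m) ℂ)) G = G := by
    have hmem := explicit_le_stabInv m (Submodule.mem_inf.mpr ⟨by
        simp only [Submodule.mem_iInf, LinearMap.mem_ker, LinearMap.sub_apply, sub_eq_zero,
          AlgHom.toLinearMap_apply, LinearMap.id_coe, id_eq]
        exact hGsand, by
        simp only [LinearMap.mem_ker, LinearMap.sub_apply, sub_eq_zero, AlgHom.toLinearMap_apply,
          LinearMap.id_coe, id_eq]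
        exact hGtr⟩)
    exact CutBitesAdjugate.mem_iInf_ker_sub_id_iff.mp hmem
  -- highest-weight extraction and the cut criterion
  obtain ⟨lam, hcard, G', hG'h, hG's, hG'w, p', hp', hG'p'⟩ :=
    CutBitesAdjugate.stub_hwExtraction m (m * 2) U G hGh hGs p hpU hGp
  refine ⟨lam, hcard, fun t ht => ?_⟩
  have : Module.Finite ℂ ↥(MvPolynomial.homogeneousSubmodule (MatIdx m × MatIdx m) ℂ (m * 2)) :=
    Module.Finite.iff_fg.mpr (MvPolynomial.homogeneousSubmodule_fg _ ℂ _)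
  refine CutBitesAdjugate.finrank_lt_of_eval_ne_zero ht ?_ hp' hG'p'
  refine Submodule.mem_inf.mpr ⟨Submodule.mem_inf.mpr ⟨Submodule.mem_inf.mpr ⟨?_, ?_⟩, ?_⟩, ?_⟩
  · exact (mem_homogeneousSubmodule _ _).mpr hG'h
  · rw [pow_zero, Ideal.one_eq_top, Submodule.restrictScalars_top]
    exact Submodule.mem_top
  · exact CutBitesAdjugate.mem_iInf_ker_sub_id_iff.mpr hG's
  · exact CutBitesAdjugate.mem_iInf_ker_sub_smul_iff.mpr hG'w

end

end Summit.ValiantsHypothesis.ValiantsHypothesis.Theorems.ValuativeFlip
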